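import Summits.ResolutionOfSingularities.ResolutionOfSingularities.Theorems.FrobeniusClosingSteerHatConeCoefficients
import Literature.Barriers.ResolutionOfSingularities.ResidualOrderUnboundedExample2
import HarnessLib

/-!
# Crux `Steer` (stmt-ResolutionOfSingularities-16345), chain W4.1 — CONE PERSISTENCE along an x-chart letter, part 2/3:
# the TARGET and the SOURCE stage in Cohen coordinates of the target

OURS (campaign `res-hironaka`, rung L ★L-G4, slot W4.1; seat res-L0-w41-stub-4 g7 on res-L0-w41-plan-1 RULINGS 196d/207(a) — «CONTINUE the cone
lemmas … `conePersistenceX_holds` is YOURS»). Replaces the role of no printed item; NOT a statement of the manuscript under review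
[claim: Hironaka2017, status: under-review]; AI-produced, weaker than expert review. Theses-free, definition-free, WORDS-FREE.

* §5 TARGET: `coeff_pure_eq_residue_coeff` — for ANY degree-`d` form `Ψ₁` with `f₁ ≡ Ψ₁(z₁,w₁) (mod (x₁,v₁)·𝔪₁^(d−1) + 𝔪₁^(d+1))`, the pure
  `X₂^i X₃^j` (`i + j = d`) coefficients of `e₁ f₁` are the residues of `Ψ₁`'s coefficients («pure-part uniqueness» for free);
  helpers `coeff_eq_zero_of_mem_span_X_pair` (degree via tree `HauserPerlega.degree_fin4`), `map_maximalIdeal_le_of_ringEquiv`.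
* §6 SOURCE through the chart: `exists_C_add_X_mul`, `map_chart_y`, `inv_one_of_mem_maximalIdeal`, `inv_of_mem_maximalIdeal_pow`
  (`φ(𝔪_S^n)` reads `X₀^n·(X₀-free part of (X₂,X₃)-degree ≤ n)` — by `Submodule.span_induction` / `mul_induction_on`, multipliers from `φ(S)
  ⊆ κ₁ + X₀·κ₁⟦X⟧`), `inv_of_mem_span_pair`, `exists_of_mem_stage_ideal`, **`coeff_source`** — `e₁ (φ f)` has NO coefficient in `X₀`-degree
  `< d`, and its `X₀^d X₁^β X₂^i X₃^j` coefficient (`i + j = d`) is `[β = 0]·ī(Ψ̄_ij)`. The source `S` is ANY local ring with a coefficient-field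
  section (no completeness used there).

[cite: CossartJannsenSaito2020, Lemma 12.1 (2)] [folklore]
bears_on: LADDER-RESOLUTION L ★L-G4 W4.1 (crux `Steer`, binder hK4ⁿᶜ, β-slots `HatBaseChangeX` / `ConePersistenceX`).
-/

noncomputable section

-- `Summit.<S>.<S>.…` duplicates the summit name by design (single-problem summit).
set_option linter.dupNamespace false

open MvPowerSeries IsLocalRing
open Literature.RingTheory.CompleteLocalRings

namespace Summit.ResolutionOfSingularities.ResolutionOfSingularities.Theorems.SwitchingDichotomy.HatBaseChange

/-! ## §5 The TARGET stage in Cohen coordinates: the pure `(X₂,X₃)`-coefficients of `e₁ f₁` are the residues of `Ψ₁`'s coefficients -/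

section Target
variable {k : Type} [Field k]

/-- An element of `span {X₀, X₁}` has no pure `(X₂,X₃)`-coefficients. -/
theorem coeff_eq_zero_of_mem_span_X_pair (G : MvPowerSeries (Fin 4) k) (hG : G ∈ Ideal.span {(X 0 : MvPowerSeries (Fin 4) k), X 1})
    (m : Fin 4 →₀ ℕ) (hm0 : m 0 = 0) (hm1 : m 1 = 0) : coeff m G = 0 := by
  obtain ⟨a, b, rfl⟩ := Ideal.mem_span_pair.mp hG
  rw [map_add, mul_comm a, mul_comm b, coeff_X_mul_eq, coeff_X_mul_eq, if_neg (by omega), if_neg (by omega), add_zero]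

variable {S₁ : Type} [CommRing S₁] [IsLocalRing S₁]

/-- A ring isomorphism onto `κ⟦X⟧` maps the maximal ideal into the maximal ideal. -/
theorem map_maximalIdeal_le_of_ringEquiv (e₁ : S₁ ≃+* MvPowerSeries (Fin 4) k) :
    (maximalIdeal S₁).map e₁.toRingHom ≤ maximalIdeal (MvPowerSeries (Fin 4) k) := by
  rw [Ideal.map_le_iff_le_comap]
  intro s hs
  rw [Ideal.mem_comap, IsLocalRing.mem_maximalIdeal, mem_nonunits_iff]
  intro hu
  exact (IsLocalRing.mem_maximalIdeal _ |>.mp hs) (by simpa using hu.map e₁.symm)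

/-- **Pure `(X₂,X₃)`-coefficients of degree `d` of `e₁ f₁` = residues of the coefficients of `Ψ₁`**, for ANY form `Ψ₁` of degree `d` with
`f₁ ≡ Ψ₁(z₁, w₁) (mod (x₁, v₁)·𝔪₁^(d−1) + 𝔪₁^(d+1))`, in Cohen coordinates `e₁` with `e₁ (x₁, v₁, z₁, w₁) = (X₀, X₁, X₂, X₃)` carrying the
coefficient field `σ₁` to the constants. In particular two such forms have the same residue form («pure-part uniqueness»). -/
theorem coeff_pure_eq_residue_coeff (e₁ : S₁ ≃+* MvPowerSeries (Fin 4) (ResidueField S₁))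
    (σ₁ : ResidueField S₁ →+* S₁) (hσ₁ : ∀ b, residue S₁ (σ₁ b) = b) (heC : ∀ b, e₁ (σ₁ b) = C b)
    (x₁ v₁ z₁ w₁ f₁ : S₁) (hex : e₁ x₁ = X 0) (hev : e₁ v₁ = X 1) (hez : e₁ z₁ = X 2) (hew : e₁ w₁ = X 3)
    (hz₁ : z₁ ∈ maximalIdeal S₁) (hw₁ : w₁ ∈ maximalIdeal S₁)
    (d : ℕ) (Ψ₁ : MvPolynomial (Fin 2) S₁) (hΨ₁ : Ψ₁.IsHomogeneous d)
    (hcong : f₁ - MvPolynomial.eval ![z₁, w₁] Ψ₁ ∈ Ideal.span {x₁, v₁} * maximalIdeal S₁ ^ (d - 1) ⊔ maximalIdeal S₁ ^ (d + 1))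
    (m : Fin 4 →₀ ℕ) (hm0 : m 0 = 0) (hm1 : m 1 = 0) (hmd : m 2 + m 3 = d) :
    coeff m (e₁ f₁) = residue S₁ (MvPolynomial.coeff (Finsupp.single 0 (m 2) + Finsupp.single 1 (m 3)) Ψ₁) := by
  classical
  -- replace the coefficients of `Ψ₁` by their `σ₁`-representatives
  set c' : (Fin 2 →₀ ℕ) → S₁ := fun e => σ₁ (residue S₁ (MvPolynomial.coeff e Ψ₁)) with hc'
  have hc'mem : ∀ e, c' e - MvPolynomial.coeff e Ψ₁ ∈ maximalIdeal S₁ := fun e => by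
    rw [← IsLocalRing.residue_eq_zero_iff, map_sub, hσ₁, sub_self]
  have hsum := eval_sub_sum_mem_pow d Ψ₁ hΨ₁ z₁ w₁ hz₁ hw₁ c' hc'mem
  -- `f₁ = Σ c'_e z₁^e₀ w₁^e₁ + r₁'`
  have hr : f₁ - ∑ e ∈ Ψ₁.support, c' e * (z₁ ^ (e 0) * w₁ ^ (e 1)) ∈
      Ideal.span {x₁, v₁} * maximalIdeal S₁ ^ (d - 1) ⊔ maximalIdeal S₁ ^ (d + 1) := by
    have : f₁ - ∑ e ∈ Ψ₁.support, c' e * (z₁ ^ (e 0) * w₁ ^ (e 1)) =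
        (f₁ - MvPolynomial.eval ![z₁, w₁] Ψ₁) +
          (MvPolynomial.eval ![z₁, w₁] Ψ₁ - ∑ e ∈ Ψ₁.support, c' e * (z₁ ^ (e 0) * w₁ ^ (e 1))) := by ring
    rw [this]
    exact Ideal.add_mem _ hcong (Ideal.mem_sup_right hsum)
  -- image of the sum under `e₁`
  have himg : e₁ (∑ e ∈ Ψ₁.support, c' e * (z₁ ^ (e 0) * w₁ ^ (e 1))) =
      ∑ e ∈ Ψ₁.support, C (residue S₁ (MvPolynomial.coeff e Ψ₁)) * (X 2 ^ (e 0) * X 3 ^ (e 1)) := by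
    rw [map_sum]
    refine Finset.sum_congr rfl fun e _ => ?_
    rw [map_mul, map_mul, map_pow, map_pow, hez, hew, hc', heC]
  -- image of the remainder has no pure coefficient of degree `d`
  obtain ⟨r₁, hr₁, r₂, hr₂, hr₁₂⟩ := Submodule.mem_sup.mp hr
  have hcoeff₁ : coeff m (e₁ r₁) = 0 := by
    refine coeff_eq_zero_of_mem_span_X_pair _ ?_ m hm0 hm1
    have hle : (Ideal.span {x₁, v₁} * maximalIdeal S₁ ^ (d - 1)).map e₁.toRingHom ≤ Ideal.span {(X 0 : MvPowerSeries _ _), X 1} := by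
      refine (Ideal.map_mono Ideal.mul_le_right).trans ?_
      rw [Ideal.map_span, Set.image_insert_eq, Set.image_singleton]
      change Ideal.span {e₁ x₁, e₁ v₁} ≤ _
      rw [hex, hev]
    exact hle (Ideal.mem_map_of_mem _ hr₁)
  have hcoeff₂ : coeff m (e₁ r₂) = 0 := by
    have hmem : e₁ r₂ ∈ maximalIdeal (MvPowerSeries (Fin 4) (ResidueField S₁)) ^ (d + 1) := by
      have hle : (maximalIdeal S₁ ^ (d + 1)).map e₁.toRingHom ≤ maximalIdeal (MvPowerSeries (Fin 4) (ResidueField S₁)) ^ (d + 1) := by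
        rw [Ideal.map_pow]
        exact Ideal.pow_right_mono (map_maximalIdeal_le_of_ringEquiv e₁) _
      exact hle (Ideal.mem_map_of_mem _ hr₂)
    refine Literature.RingTheory.MvPowerSeries.Jets.coeff_eq_zero_of_mem_maximalIdeal_pow hmem ?_
    rw [Literature.Barriers.ResolutionOfSingularities.HauserPerlega.degree_fin4]; omega
  -- assemble
  have hf₁ : f₁ = ∑ e ∈ Ψ₁.support, c' e * (z₁ ^ (e 0) * w₁ ^ (e 1)) + (r₁ + r₂) := by rw [hr₁₂]; ring
  rw [hf₁, map_add, map_add, map_add, map_add, himg, hcoeff₁, hcoeff₂, add_zero, add_zero,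
    coeff_sum_C_mul_X_pow _ _ m hm0 hm1]
  by_cases hmem : Finsupp.single (0 : Fin 2) (m 2) + Finsupp.single 1 (m 3) ∈ Ψ₁.support
  · rw [if_pos hmem]
  · rw [if_neg hmem, MvPolynomial.notMem_support_iff.mp hmem, map_zero]

end Target


/-! ## §6 The SOURCE stage through the chart, in Cohen coordinates of the target -/

section Source
variable {S S₁ : Type} [CommRing S] [IsLocalRing S] [CommRing S₁] [IsLocalRing S₁]
  (φ : S →+* S₁) (σ : ResidueField S →+* S) (σ₁ : ResidueField S₁ →+* S₁)
  (e₁ : S₁ ≃+* MvPowerSeries (Fin 4) (ResidueField S₁))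
  (x y z w : S) (c : ResidueField S₁) (v₁ z₁ w₁ : S₁)
  (hσ : ∀ a, residue S (σ a) = a) (heC : ∀ b, e₁ (σ₁ b) = C b)
  (hcompat : ∀ a, φ (σ a) = σ₁ (residue S₁ (φ (σ a))))
  (hspan : Ideal.span {x, y, z, w} = maximalIdeal S)
  (hex : e₁ (φ x) = X 0) (hev : e₁ v₁ = X 1)
  (hy : φ y = φ x * (σ₁ c + v₁)) (hz : φ z = φ x * z₁) (hw : φ w = φ x * w₁)

include hσ heC hcompat hspan hy hz hw hex in
/-- `e₁ (φ s) = C α + X₀·H`. -/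
theorem exists_C_add_X_mul (s : S) : ∃ (α : ResidueField S₁) (H : MvPowerSeries (Fin 4) (ResidueField S₁)), e₁ (φ s) = C α + X 0 * H := by
  obtain ⟨g, hg⟩ := exists_eq_section_add_mul_of_chart φ σ σ₁ x y z w c v₁ z₁ w₁ hσ hcompat hspan hy hz hw s
  exact ⟨_, e₁ g, by rw [hg, map_add, map_mul, hex, heC]⟩

omit [IsLocalRing S] in
include heC hy hex hev in
/-- `e₁ (φ y) = X₀ · (C c + X₁)`. -/
theorem map_chart_y : e₁ (φ y) = X 0 * (C c + X 1) := by
  rw [hy, map_mul, map_add, hex, heC, hev]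

include hσ heC hcompat hspan hy hz hw hex hev in
/-- **Elements of `𝔪_S` read `X₀ · T′` with `(X₂,X₃)`-degree `≤ 1` off `X₀`.** -/
theorem inv_one_of_mem_maximalIdeal (hez : e₁ z₁ = X 2) (hew : e₁ w₁ = X 3) (t : S) (ht : t ∈ maximalIdeal S) :
    ∃ T' : MvPowerSeries (Fin 4) (ResidueField S₁), e₁ (φ t) = X 0 ^ 1 * T' ∧
      ∀ m : Fin 4 →₀ ℕ, m 0 = 0 → coeff m T' ≠ 0 → m 2 + m 3 ≤ 1 := by
  rw [← hspan] at ht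
  induction ht using Submodule.span_induction with
  | mem t ht =>
    simp only [Set.mem_insert_iff, Set.mem_singleton_iff] at ht
    rcases ht with h | h | h | h <;> rw [h]
    · exact ⟨1, by rw [hex, pow_one, mul_one], by simpa using degBound_C (1 : ResidueField S₁) 1⟩
    · exact ⟨C c + X 1, by rw [map_chart_y φ σ₁ e₁ x y c v₁ heC hex hev hy, pow_one], degBound_C_add_X_one c 1⟩
    · exact ⟨X 2, by rw [hz, map_mul, hex, hez, pow_one], degBound_X_two_three 2 (Or.inl rfl)⟩
    · exact ⟨X 3, by rw [hw, map_mul, hex, hew, pow_one], degBound_X_two_three 3 (Or.inr rfl)⟩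
  | zero => exact ⟨0, by simp, fun m _ h => by simp at h⟩
  | add t t' _ _ iht iht' =>
    obtain ⟨T, hT, hdT⟩ := iht
    obtain ⟨T', hT', hdT'⟩ := iht'
    exact ⟨T + T', by rw [map_add, map_add, hT, hT', mul_add], degBound_add hdT hdT'⟩
  | smul g t _ iht =>
    obtain ⟨T, hT, hdT⟩ := iht
    obtain ⟨α, H, hg⟩ := exists_C_add_X_mul φ σ σ₁ e₁ x y z w c v₁ z₁ w₁ hσ heC hcompat hspan hex hy hz hw g
    obtain ⟨G'', hG'', hdG''⟩ := inv_mul_of_C_add 1 1 α H T hdT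
    exact ⟨G'', by rw [smul_eq_mul, map_mul, map_mul, hg, hT, hG''], hdG''⟩

include hσ heC hcompat hspan hy hz hw hex hev in
/-- **Elements of `𝔪_S^n` read `X₀^n · T′` with `(X₂,X₃)`-degree `≤ n` off `X₀`.** -/
theorem inv_of_mem_maximalIdeal_pow (hez : e₁ z₁ = X 2) (hew : e₁ w₁ = X 3) (n : ℕ) (t : S) (ht : t ∈ maximalIdeal S ^ n) :
    ∃ T' : MvPowerSeries (Fin 4) (ResidueField S₁), e₁ (φ t) = X 0 ^ n * T' ∧
      ∀ m : Fin 4 →₀ ℕ, m 0 = 0 → coeff m T' ≠ 0 → m 2 + m 3 ≤ n := by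
  induction n generalizing t with
  | zero =>
    obtain ⟨α, H, ht'⟩ := exists_C_add_X_mul φ σ σ₁ e₁ x y z w c v₁ z₁ w₁ hσ heC hcompat hspan hex hy hz hw t
    exact ⟨e₁ (φ t), by rw [pow_zero, one_mul], by rw [ht']; exact degBound_add (degBound_C α 0) (degBound_X_zero_mul H 0)⟩
  | succ n ih =>
    rw [pow_succ] at ht
    refine Submodule.mul_induction_on ht (fun a ha b hb => ?_) (fun t t' iht iht' => ?_)
    · obtain ⟨A, hA, hdA⟩ := ih a ha
      obtain ⟨B, hB, hdB⟩ := inv_one_of_mem_maximalIdeal φ σ σ₁ e₁ x y z w c v₁ z₁ w₁ hσ heC hcompat hspan hex hev hy hz hw hez hew b hb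
      obtain ⟨hprod, hdAB⟩ := inv_mul_inv A B hdA hdB
      exact ⟨A * B, by rw [map_mul, map_mul, hA, hB, hprod], hdAB⟩
    · obtain ⟨T, hT, hdT⟩ := iht
      obtain ⟨T', hT', hdT'⟩ := iht'
      exact ⟨T + T', by rw [map_add, map_add, hT, hT', mul_add], degBound_add hdT hdT'⟩

include heC hcompat hspan hy hz hw hex hev hσ in
/-- **Elements of `(x, y)` read `X₀ · A′` with NO `X₂, X₃` off `X₀`.** -/
theorem inv_of_mem_span_pair (a : S) (ha : a ∈ Ideal.span {x, y}) :
    ∃ A' : MvPowerSeries (Fin 4) (ResidueField S₁), e₁ (φ a) = X 0 * A' ∧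
      ∀ m : Fin 4 →₀ ℕ, m 0 = 0 → coeff m A' ≠ 0 → m 2 + m 3 ≤ 0 := by
  induction ha using Submodule.span_induction with
  | mem t ht =>
    simp only [Set.mem_insert_iff, Set.mem_singleton_iff] at ht
    rcases ht with h | h <;> rw [h]
    · exact ⟨1, by rw [hex, mul_one], by simpa using degBound_C (1 : ResidueField S₁) 0⟩
    · exact ⟨C c + X 1, map_chart_y φ σ₁ e₁ x y c v₁ heC hex hev hy, degBound_C_add_X_one c 0⟩
  | zero => exact ⟨0, by simp, fun m _ h => by simp at h⟩
  | add t t' _ _ iht iht' =>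
    obtain ⟨T, hT, hdT⟩ := iht
    obtain ⟨T', hT', hdT'⟩ := iht'
    exact ⟨T + T', by rw [map_add, map_add, hT, hT', mul_add], degBound_add hdT hdT'⟩
  | smul g t _ iht =>
    obtain ⟨T, hT, hdT⟩ := iht
    obtain ⟨α, H, hg⟩ := exists_C_add_X_mul φ σ σ₁ e₁ x y z w c v₁ z₁ w₁ hσ heC hcompat hspan hex hy hz hw g
    obtain ⟨G'', hG'', hdG''⟩ := inv_mul_of_C_add_one 0 α H T hdT
    exact ⟨G'', by rw [smul_eq_mul, map_mul, map_mul, hg, hT, hG''], hdG''⟩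

include hσ heC hcompat hspan hy hz hw hex hev in
/-- **The stage remainder through the chart**: `r ∈ (x,y)·𝔪^(d−1) + 𝔪^(d+1)` reads `X₀^d · R′` where `R′` has NO pure `(X₂,X₃)`-monomial of
degree `d` off `X₀`. -/
theorem exists_of_mem_stage_ideal (hez : e₁ z₁ = X 2) (hew : e₁ w₁ = X 3) (d : ℕ) (hd : 1 ≤ d) (r : S)
    (hr : r ∈ Ideal.span {x, y} * maximalIdeal S ^ (d - 1) ⊔ maximalIdeal S ^ (d + 1)) :
    ∃ R' : MvPowerSeries (Fin 4) (ResidueField S₁), e₁ (φ r) = X 0 ^ d * R' ∧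
      ∀ m : Fin 4 →₀ ℕ, m 0 = 0 → m 2 + m 3 = d → coeff m R' = 0 := by
  obtain ⟨r₁, hr₁, r₂, hr₂, rfl⟩ := Submodule.mem_sup.mp hr
  -- the `(x,y)·𝔪^(d−1)` part: degree bound `d − 1`
  have h₁ : ∃ R₁ : MvPowerSeries (Fin 4) (ResidueField S₁), e₁ (φ r₁) = X 0 ^ d * R₁ ∧
      ∀ m : Fin 4 →₀ ℕ, m 0 = 0 → coeff m R₁ ≠ 0 → m 2 + m 3 ≤ d - 1 := by
    refine Submodule.mul_induction_on hr₁ (fun a ha b hb => ?_) (fun t t' iht iht' => ?_)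
    · obtain ⟨A, hA, hdA⟩ := inv_of_mem_span_pair φ σ σ₁ e₁ x y z w c v₁ z₁ w₁ hσ heC hcompat hspan hex hev hy hz hw a ha
      obtain ⟨B, hB, hdB⟩ :=
        inv_of_mem_maximalIdeal_pow φ σ σ₁ e₁ x y z w c v₁ z₁ w₁ hσ heC hcompat hspan hex hev hy hz hw hez hew (d - 1) b hb
      refine ⟨A * B, ?_, by simpa using degBound_mul hdA hdB⟩
      rw [map_mul, map_mul, hA, hB]
      rw [show (X 0 : MvPowerSeries (Fin 4) (ResidueField S₁)) ^ d = X 0 * X 0 ^ (d - 1) by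
        rw [← pow_succ', Nat.sub_add_cancel hd]]
      ring
    · obtain ⟨T, hT, hdT⟩ := iht
      obtain ⟨T', hT', hdT'⟩ := iht'
      exact ⟨T + T', by rw [map_add, map_add, hT, hT', mul_add], degBound_add hdT hdT'⟩
  obtain ⟨R₁, hR₁, hdR₁⟩ := h₁
  obtain ⟨R₂, hR₂, -⟩ :=
    inv_of_mem_maximalIdeal_pow φ σ σ₁ e₁ x y z w c v₁ z₁ w₁ hσ heC hcompat hspan hex hev hy hz hw hez hew (d + 1) r₂ hr₂
  refine ⟨R₁ + X 0 * R₂, by rw [map_add, map_add, hR₁, hR₂, pow_succ]; ring, fun m hm0 hmd => ?_⟩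
  rw [map_add, coeff_X_zero_mul_of_apply_eq_zero m hm0, add_zero]
  by_contra hne
  have := hdR₁ m hm0 hne
  omega

include hσ heC hcompat hspan hy hz hw hex hev in
/-- **The SOURCE stage through the chart, in Cohen coordinates of the target.** For a degree-`d` form `Ψ` with
`f ≡ Ψ(z, w) (mod (x,y)·𝔪^(d−1) + 𝔪^(d+1))`: `e₁ (φ f)` has NO coefficient in `X₀`-degree `< d`, and its coefficient at
`X₀^d X₁^β X₂^i X₃^j` (`i + j = d`) is `ī(Ψ̄_ij)` for `β = 0` and `0` for `β ≥ 1` (`ī = residue₁ ∘ φ ∘ σ`). -/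
theorem coeff_source (hez : e₁ z₁ = X 2) (hew : e₁ w₁ = X 3) (d : ℕ) (hd : 1 ≤ d) (f : S) (Ψ : MvPolynomial (Fin 2) S)
    (hΨ : Ψ.IsHomogeneous d)
    (hcong : f - MvPolynomial.eval ![z, w] Ψ ∈ Ideal.span {x, y} * maximalIdeal S ^ (d - 1) ⊔ maximalIdeal S ^ (d + 1))
    (m : Fin 4 →₀ ℕ) (hmd : m 2 + m 3 = d) :
    (m 0 < d → coeff m (e₁ (φ f)) = 0) ∧
    (m 0 = d → coeff m (e₁ (φ f)) = if m 1 = 0 then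
      residue S₁ (φ (σ (residue S (MvPolynomial.coeff (Finsupp.single 0 (m 2) + Finsupp.single 1 (m 3)) Ψ)))) else 0) := by
  classical
  have hzS : z ∈ maximalIdeal S := by rw [← hspan]; exact Ideal.subset_span (by simp)
  have hwS : w ∈ maximalIdeal S := by rw [← hspan]; exact Ideal.subset_span (by simp)
  -- replace the coefficients of `Ψ` by their `σ`-representatives
  set c' : (Fin 2 →₀ ℕ) → S := fun e => σ (residue S (MvPolynomial.coeff e Ψ)) with hc'
  have hc'mem : ∀ e, c' e - MvPolynomial.coeff e Ψ ∈ maximalIdeal S := fun e => by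
    rw [← IsLocalRing.residue_eq_zero_iff, map_sub, hσ, sub_self]
  have hsum := eval_sub_sum_mem_pow d Ψ hΨ z w hzS hwS c' hc'mem
  have hr : f - ∑ e ∈ Ψ.support, c' e * (z ^ (e 0) * w ^ (e 1)) ∈
      Ideal.span {x, y} * maximalIdeal S ^ (d - 1) ⊔ maximalIdeal S ^ (d + 1) := by
    have : f - ∑ e ∈ Ψ.support, c' e * (z ^ (e 0) * w ^ (e 1)) =
        (f - MvPolynomial.eval ![z, w] Ψ) + (MvPolynomial.eval ![z, w] Ψ - ∑ e ∈ Ψ.support, c' e * (z ^ (e 0) * w ^ (e 1))) := by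
      ring
    rw [this]
    exact Ideal.add_mem _ hcong (Ideal.mem_sup_right hsum)
  obtain ⟨R', hR', hdR'⟩ :=
    exists_of_mem_stage_ideal φ σ σ₁ e₁ x y z w c v₁ z₁ w₁ hσ heC hcompat hspan hex hev hy hz hw hez hew d hd _ hr
  -- image of the representative sum: `X₀^d · Σ C(ī c̄_e) X₂^e₀ X₃^e₁`
  set β : (Fin 2 →₀ ℕ) → ResidueField S₁ := fun e => residue S₁ (φ (σ (residue S (MvPolynomial.coeff e Ψ)))) with hβ
  have himg : e₁ (φ (∑ e ∈ Ψ.support, c' e * (z ^ (e 0) * w ^ (e 1)))) =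
      X 0 ^ d * ∑ e ∈ Ψ.support, C (β e) * (X 2 ^ (e 0) * X 3 ^ (e 1)) := by
    rw [map_sum, map_sum, Finset.mul_sum]
    refine Finset.sum_congr rfl fun e he => ?_
    have hdeg : e 0 + e 1 = d := by
      have := hΨ (MvPolynomial.mem_support_iff.mp he)
      rw [← this, Finsupp.weight_apply]
      simp [Finsupp.sum_fintype, Fin.sum_univ_two]
    have hce : e₁ (φ (c' e)) = C (β e) := by
      rw [hc']
      change e₁ (φ (σ _)) = _
      rw [hcompat, heC]
    simp only [map_mul, map_pow, hz, hw, hex, hez, hew]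
    rw [hce, mul_pow, mul_pow, ← hdeg, pow_add]
    ring
  have hf : f = ∑ e ∈ Ψ.support, c' e * (z ^ (e 0) * w ^ (e 1)) + (f - ∑ e ∈ Ψ.support, c' e * (z ^ (e 0) * w ^ (e 1))) := by
    ring
  have hF : e₁ (φ f) = X 0 ^ d * (∑ e ∈ Ψ.support, C (β e) * (X 2 ^ (e 0) * X 3 ^ (e 1)) + R') := by
    rw [hf, map_add, map_add, himg, hR', mul_add]
  refine ⟨fun hlt => ?_, fun heq => ?_⟩
  · rw [hF, coeff_X_pow_mul_eq, if_neg (by omega)]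
  · rw [hF, coeff_X_pow_mul_eq, if_pos (by omega), map_add]
    have h0 : (m - Finsupp.single (0 : Fin 4) d) 0 = 0 := by simp [heq]
    have h1 : (m - Finsupp.single (0 : Fin 4) d) 1 = m 1 := by simp
    have h2 : (m - Finsupp.single (0 : Fin 4) d) 2 = m 2 := by simp
    have h3 : (m - Finsupp.single (0 : Fin 4) d) 3 = m 3 := by simp
    rw [hdR' _ h0 (by rw [h2, h3, hmd]), add_zero]
    by_cases hm1 : m 1 = 0
    · rw [if_pos hm1, coeff_sum_C_mul_X_pow _ _ _ h0 (by rw [h1, hm1]), h2, h3]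
      by_cases hmem : Finsupp.single (0 : Fin 2) (m 2) + Finsupp.single 1 (m 3) ∈ Ψ.support
      · rw [if_pos hmem]
      · rw [if_neg hmem, MvPolynomial.notMem_support_iff.mp hmem, map_zero, map_zero, map_zero, map_zero]
    · rw [if_neg hm1, coeff_sum_C_mul_X_pow_of_ne _ _ _ (Or.inr (by rw [h1]; exact hm1))]

end Source
end Summit.ResolutionOfSingularities.ResolutionOfSingularities.Theorems.SwitchingDichotomy.HatBaseChange

end
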